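import Mathlib
import Literature.Algebra.EuclideanLattices.DualLattice
import Literature.Algebra.EuclideanLattices.QaryLatticeDuality
import HarnessLib

/-!
# Stub `stub_rowLatticeEuc` of line `Sketch` (crux `MagicFunctionsPersist`, item stmt-PneNP-2328)

The `q`-ary lattice `L = Λ_q(Aᵀ) = rowLattice A ⊆ ℤⁿ` (tree, `GadgetTrapdoor.lean`), pushed into
`ℝⁿ = EuclideanSpace ℝ (Fin n)` by the `ℤ`-linear embedding `intToEuc (Fin n)`
(`QaryLatticeDuality.lean`), is a full-rank lattice, and every dual vector `w ∈ L*` has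
`q • w ∈ Λ_q^⊥(A) = perpLattice A` (the easy inclusion `Λ_q(Aᵀ)^* ⊆ q⁻¹ Λ_q^⊥(A)`, valid for ANY
`A`; Micciancio–Peikert 2012, §2.2):

* discrete: `L ≤ ℤⁿ = stdIntLattice n` (`IntegerBases.lean`), which is discrete (Mathlib's `ZSpan`
  instance), and `DiscreteTopology.of_subset`;
* full rank: `L` contains `q • eⱼ = intToEuc ((q : ℤ) • Pi.single j 1)` (`qsmul_mem_rowLattice`), so
  its real span contains the standard basis;
* dual transfer: pairing `w ∈ L*` with `q • eⱼ ∈ L` shows `q wⱼ ∈ ℤ`, so `q • w = intToEuc x` for an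
  integer vector `x`, and `x ⬝ᵥ y = q ⟪w, intToEuc y⟫ ∈ qℤ` for every `y ∈ Λ_q(Aᵀ)`, whence
  `x ∈ Λ_q^⊥(A)` by `mem_perpLattice_iff_forall_dvd` (the argument of the tree's
  `smul_mem_of_mem_dualLattice_perpLattice` with the roles of `Λ^⊥` and `Λ(Aᵀ)` swapped; this
  direction needs no primitivity of `A`).
-/

set_option linter.dupNamespace false -- `Summit.PneNP.PneNP.…`: summit = sub-problem (D-0017)

noncomputable section

open scoped InnerProductSpace
open Submodule Literature.Algebra.EuclideanLattices

namespace Summit.PneNP.PneNP.Theorems.LatticeMagicMagicFunctionsPersist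

/-- The embedded `q`-ary lattice `Λ_q(Aᵀ) ⊆ ℝⁿ` sits inside the standard integer lattice `ℤⁿ`. -/
theorem map_rowLattice_le_stdIntLattice {n k q : ℕ} (A : Matrix (Fin k) (Fin n) (ZMod q)) :
    (rowLattice A).map (intToEuc (Fin n)) ≤ stdIntLattice n := by
  rintro _ ⟨y, -, rfl⟩
  exact intVecToEuclidean_mem_stdIntLattice n y

/-- The scaled standard basis vector `q • eⱼ` is the embedding of the integer vector
`(q : ℤ) • Pi.single j 1`. -/
theorem intToEuc_qsmul_single {n : ℕ} (q : ℕ) (j : Fin n) :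
    intToEuc (Fin n) ((q : ℤ) • Pi.single j 1) = (q : ℝ) • EuclideanSpace.single j (1 : ℝ) := by
  ext l
  by_cases h : l = j
  · subst h; simp
  · simp [h]

/-- The scaled standard basis vectors `q • eⱼ` lie in the embedded lattice `Λ_q(Aᵀ) ⊆ ℝⁿ`
(because `qℤⁿ ⊆ Λ_q(Aᵀ)`). -/
theorem qsmul_single_mem_map_rowLattice {n k q : ℕ} (A : Matrix (Fin k) (Fin n) (ZMod q)) (j : Fin n) :
    (q : ℝ) • EuclideanSpace.single j (1 : ℝ) ∈ (rowLattice A).map (intToEuc (Fin n)) :=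
  ⟨_, qsmul_mem_rowLattice A _, intToEuc_qsmul_single q j⟩

/-- The embedded lattice `Λ_q(Aᵀ) ⊆ ℝⁿ` spans `ℝⁿ` over `ℝ` when `q ≠ 0`: its real span contains
every standard basis vector `eⱼ = q⁻¹ • (q • eⱼ)`. -/
theorem span_map_rowLattice_eq_top {n k q : ℕ} [NeZero q] (A : Matrix (Fin k) (Fin n) (ZMod q)) :
    span ℝ ((rowLattice A).map (intToEuc (Fin n)) : Set (EuclideanSpace ℝ (Fin n))) = ⊤ := by
  have hq0 : (q : ℝ) ≠ 0 := by exact_mod_cast NeZero.ne q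
  refine eq_top_iff.2 ?_
  rw [← (EuclideanSpace.basisFun (Fin n) ℝ).toBasis.span_eq, span_le]
  rintro _ ⟨j, rfl⟩
  have heq : (EuclideanSpace.basisFun (Fin n) ℝ).toBasis j =
      (q : ℝ)⁻¹ • ((q : ℝ) • EuclideanSpace.single j (1 : ℝ)) := by
    rw [smul_smul, inv_mul_cancel₀ hq0, one_smul, OrthonormalBasis.coe_toBasis,
      EuclideanSpace.basisFun_apply]
  rw [SetLike.mem_coe, heq]
  exact smul_mem _ _ (subset_span (qsmul_single_mem_map_rowLattice A j))

/-- **The `q`-ary lattice `Λ_q(Aᵀ)` inside `ℝⁿ`.** The image `L` of `rowLattice A ⊆ ℤⁿ` under the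
embedding `ℤⁿ ↪ ℝⁿ` is a full-rank lattice (discrete because it sits in `ℤⁿ`, full rank because it
contains `qℤⁿ`), and every dual vector `w ∈ L*` satisfies `q w ∈ Λ_q^⊥(A)` (pair `w` with `q eⱼ`
and with the lifts of the rows of `A`; the easy inclusion `Λ_q(Aᵀ)* ⊆ q⁻¹ Λ_q^⊥(A)`,
Micciancio–Peikert 2012, §2.2). -/
theorem stub_rowLatticeEuc {n k q : ℕ} [NeZero q] (A : Matrix (Fin k) (Fin n) (ZMod q)) :
    ∃ _ : DiscreteTopology ((rowLattice A).map (intToEuc (Fin n))),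
    IsZLattice ℝ ((rowLattice A).map (intToEuc (Fin n))) ∧
    ∀ w ∈ dualLattice ((rowLattice A).map (intToEuc (Fin n))),
      ∃ x ∈ perpLattice A, intToEuc (Fin n) x = (q : ℝ) • w := by
  have hdisc : DiscreteTopology ((rowLattice A).map (intToEuc (Fin n))) :=
    DiscreteTopology.of_subset (s := (stdIntLattice n : Set (EuclideanSpace ℝ (Fin n))))
      (inferInstanceAs (DiscreteTopology (stdIntLattice n))) (map_rowLattice_le_stdIntLattice A)
  refine ⟨hdisc, ⟨span_map_rowLattice_eq_top A⟩, fun w hw => ?_⟩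
  rw [mem_dualLattice] at hw
  -- `q • w` is an integer vector `x`: pair `w` with `q • eⱼ ∈ L`
  have hint : ∀ j, ∃ m : ℤ, (m : ℝ) = (q : ℝ) * w j := by
    intro j
    obtain ⟨m, hm⟩ := hw _ ⟨(q : ℤ) • Pi.single j 1, qsmul_mem_rowLattice A _, rfl⟩
    refine ⟨m, ?_⟩
    rw [hm, inner_intToEuc_right]
    simp [Pi.single_apply, mul_comm]
  choose x hx using hint
  have hxw : intToEuc (Fin n) x = (q : ℝ) • w := by
    ext j; simp [hx]
  refine ⟨x, ?_, hxw⟩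
  -- `x` pairs into `qℤ` with `Λ_q(Aᵀ)`: `x ⬝ᵥ y = q ⟪w, y⟫`
  refine (mem_perpLattice_iff_forall_dvd A x).2 fun y hy => ?_
  obtain ⟨m, hm⟩ := hw _ ⟨y, hy, rfl⟩
  refine ⟨m, ?_⟩
  have h : ((x ⬝ᵥ y : ℤ) : ℝ) = (q : ℝ) * m := by
    rw [← inner_intToEuc, hxw, real_inner_smul_left, hm]
  exact_mod_cast h

end Summit.PneNP.PneNP.Theorems.LatticeMagicMagicFunctionsPersist

end
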